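import Mathlib
import HarnessLib
import Summits.ResolutionOfSingularities.ResolutionOfSingularities.Theorems.WildQuotientsWildQuotientResolutionTerminalBlowupSpec
import Summits.ResolutionOfSingularities.ResolutionOfSingularities.Theorems.WildQuotientsWildQuotientResolutionStubStableAffineCoverBlowup
import Summits.ResolutionOfSingularities.ResolutionOfSingularities.Theorems.WildQuotientsGaloisQuotientStableCover
import Summits.ResolutionOfSingularities.ResolutionOfSingularities.Theorems.WildQuotientsWildQuotientResolutionNBlocksAlgebra
import Summits.ResolutionOfSingularities.ResolutionOfSingularities.Theorems.WildQuotientsWildQuotientResolutionNBlocksBlowup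
import Summits.ResolutionOfSingularities.ResolutionOfSingularities.Theorems.WildQuotientsWildQuotientResolutionNBlocksAssembly
import Literature.AlgebraicGeometry.Resolution.AffineBlowupUniversal

/-!
# The terminal model of `𝔸²ⁿ/(J₂^{⊕n})`: one blow-up of `V(x_{0,i} : i)` (rung LSB, all-blocks-2 core)
(crux stmt-ResolutionOfSingularities-15640 `WildQuotients.WildQuotientResolution`, line `Sketch`;
chain w45c `L/w45c/CHAIN.md` v3 §4, stub-2 «then»: the NBlocks model instance)

[OURS · L1 W4.5c; NOT a statement of the manuscript.] For `σ = J₂^{⊕n}` on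
`k[x_{0,i}, x_{1,i} : i < n]` (`σ x_{1,i} = x_{1,i} + x_{0,i}`, `x_{0,i}` fixed; `n ≥ 1`,
characteristic `p`, so `⟨σ⟩ ≅ ℤ/p`) and the action `ρ g = Spec (g⁻¹)` on `𝔸²ⁿ`
(`AffineQuotient.exists_specAction`), the blow-up `V = Bl_I 𝔸²ⁿ` of the fixed subspace
`I = (x_{0,i} : i)` with the lifted action is a Király–Lütkebohmert TERMINAL MODEL in the
sense of `CyclicTransfer.cyclicDivisorialTransfer_of_card` / `CyclicDivisorialModelsLE`
(`nBlocks_terminalModel`): proper, birational, integral, regular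
(`NBlocks.nBlocks_blowup_regular`, p470023), `π` equivariant (`IsBlowup.liftAction_hom_comp`),
`⟨σ⟩`-stable affine cover (`StableAffineCoverBlowup.stub_stableAffineCoverBlowup`), and
principal stalk augmentation ideals at fixed points — for `g = 1` the zero ideal, for `g ≠ 1`
by `TerminalBlowup.isPrincipal_stalkAug_liftAction_spec` (p469646), `I` being the augmentation
ideal of `g` with `g`-invariant generators (`NBlocks.smul_X_fst`, `smul_sub_mem_centre`,
`X_fst_mem_augIdeal`, p469941). This is exactly the hypothesis `hmodel` of
`NBlocks.nBlocksQuotient_hasResolution_of_model` (p470077): with it, `𝔸²ⁿ/(J₂^{⊕n})` — for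
`n ≥ 3` a NON-Cohen–Macaulay wild quotient singularity (Ellingsrud–Skjelbred) — is resolved in
every characteristic `p` (`nBlocksQuotient_hasResolution`).
-/

-- single-problem summit: the doubled namespace component `ResolutionOfSingularities` is forced
set_option linter.dupNamespace false

noncomputable section

open CategoryTheory AlgebraicGeometry TopologicalSpace MvPolynomial
open Literature.AlgebraicGeometry.Resolution

namespace Summit.ResolutionOfSingularities.ResolutionOfSingularities.Theorems.WildQuotientResolution.NBlocks

/-- **The terminal model of `𝔸²ⁿ/(J₂^{⊕n})`** (the hypothesis `hmodel` of
`nBlocksQuotient_hasResolution_of_model`): for `σ = J₂^{⊕n}` (`h0`, `h1`), `n ≥ 1`, a field `k`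
of characteristic `p` and the action `ρ g = Spec (g⁻¹)` of `⟨σ⟩` on `𝔸²ⁿ`, the blow-up
`V = Bl_{(x_{0,i})} 𝔸²ⁿ` with the lifted action is proper, birational, integral, regular,
`π`-equivariant, covered by `⟨σ⟩`-stable affine opens, and has principal stalk augmentation
ideals at every fixed point of every `g ∈ ⟨σ⟩`. (`V` regular etc.: `nBlocks_blowup_regular`;
lift: `IsBlowup.liftAction` along the `⟨σ⟩`-stable ideal sheaf `idealSheaf_centre_comap`; cover:
`StableAffineCoverBlowup.stub_stableAffineCoverBlowup` over `𝔸²ⁿ → Spec k`; divisorial clause: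
zero ideal for `g = 1`, else `TerminalBlowup.isPrincipal_stalkAug_liftAction_spec` with the
invariant generators `x_{0,i}` of the augmentation ideal of `g`.)
[folklore; assembly of landed decls] -/
theorem nBlocks_terminalModel (p : ℕ) (hp : p.Prime) (k : Type) [Field k] [CharP k p]
    (n : ℕ) (hn : 0 < n)
    (σ : MvPolynomial (Fin 2 × Fin n) k ≃ₐ[k] MvPolynomial (Fin 2 × Fin n) k)
    (h0 : ∀ i, σ (X (0, i)) = X (0, i)) (h1 : ∀ i, σ (X (1, i)) = X (1, i) + X (0, i))
    (ρ : ↥(Subgroup.zpowers σ) →* Aut (Spec (CommRingCat.of (MvPolynomial (Fin 2 × Fin n) k))))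
    (hρ : ∀ g : ↥(Subgroup.zpowers σ), (ρ g).hom = Spec.map (CommRingCat.ofHom
      ((MulSemiringAction.toRingEquiv (↥(Subgroup.zpowers σ)) (MvPolynomial (Fin 2 × Fin n) k) g⁻¹ :
        MvPolynomial (Fin 2 × Fin n) k ≃+* MvPolynomial (Fin 2 × Fin n) k) :
          MvPolynomial (Fin 2 × Fin n) k →+* MvPolynomial (Fin 2 × Fin n) k))) :
    ∃ (V : Scheme.{0}) (π : V ⟶ Spec (CommRingCat.of (MvPolynomial (Fin 2 × Fin n) k)))
      (ρV : ↥(Subgroup.zpowers σ) →* Aut V), IsProper π ∧ IsBirational π ∧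
      IsIntegral V ∧ Scheme.IsRegular V ∧
      (∀ g : ↥(Subgroup.zpowers σ), (ρV g).hom ≫ π = π ≫ (ρ g).hom) ∧
      (∀ v : V, ∃ W : V.Opens, IsAffineOpen W ∧ v ∈ W ∧
        ∀ g : ↥(Subgroup.zpowers σ), (ρV g).hom ⁻¹ᵁ W = W) ∧
      ∀ (g : ↥(Subgroup.zpowers σ)) (v : V) (hv : (ρV g).hom.base v = v),
        (Ideal.span (Set.range fun s : V.presheaf.stalk v =>
          (V.presheaf.stalkSpecializes (specializes_of_eq hv) ≫ (ρV g).hom.stalkMap v).hom s -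
            s)).IsPrincipal := by
  classical
  obtain ⟨hσp, -, hcard⟩ := nBlocks_order k n σ h0 h1 p hp hn
  haveI : Finite (↥(Subgroup.zpowers σ)) := Nat.finite_of_card_ne_zero (hcard ▸ hp.ne_zero)
  -- the blow-up of the centre and its lifted action
  set I : Ideal (MvPolynomial (Fin 2 × Fin n) k) :=
    Ideal.span (Set.range fun i : Fin n => (X (0, i) : MvPolynomial (Fin 2 × Fin n) k)) with hI
  have hπ : IsBlowup (affineBlowup.π I) (affineBlowup.idealSheaf I) := affineBlowup.isBlowup I
  obtain ⟨hVreg, hVint, hVprop, hbir⟩ := nBlocks_blowup_regular k n hn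
  have hJ : ∀ g : ↥(Subgroup.zpowers σ),
      (affineBlowup.idealSheaf I).comap (ρ g).hom = affineBlowup.idealSheaf I :=
    idealSheaf_centre_comap k n σ h0 ρ hρ
  have hsmul : ∀ (g : ↥(Subgroup.zpowers σ)) (b : MvPolynomial (Fin 2 × Fin n) k),
      g • b = (g : MvPolynomial (Fin 2 × Fin n) k ≃ₐ[k] MvPolynomial (Fin 2 × Fin n) k) b :=
    fun g b => rfl
  refine ⟨affineBlowup I, affineBlowup.π I, hπ.liftAction ρ hJ, hVprop, hbir, hVint, hVreg,
    fun g => hπ.liftAction_hom_comp ρ hJ g, ?_, ?_⟩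
  · -- Mumford's hypothesis
    intro v
    let q : Spec (CommRingCat.of (MvPolynomial (Fin 2 × Fin n) k)) ⟶ Spec (CommRingCat.of k) :=
      Spec.map (CommRingCat.ofHom (algebraMap k (MvPolynomial (Fin 2 × Fin n) k)))
    haveI : IsAffineHom q := isAffineHom_of_isAffine_of_isSeparated q
    have hρq : ∀ g : ↥(Subgroup.zpowers σ), (ρ g).hom ≫ q = q := by
      intro g
      simp only [q, hρ, ← Spec.map_comp, ← CommRingCat.ofHom_comp]
      congr 2
      refine RingHom.ext fun c => ?_
      change (MulSemiringAction.toRingEquiv _ _ g⁻¹) (algebraMap k _ c) = algebraMap k _ c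
      rw [MulSemiringAction.toRingEquiv_apply_apply, hsmul]
      exact (↑(g⁻¹) : MvPolynomial (Fin 2 × Fin n) k ≃ₐ[k] MvPolynomial (Fin 2 × Fin n) k).commutes c
    exact StableAffineCoverBlowup.stub_stableAffineCoverBlowup q ρ hρq hπ (hπ.liftAction ρ hJ)
      (fun g => hπ.liftAction_hom_comp ρ hJ g) v
  · -- the divisorial clause at fixed points
    intro g v hv
    by_cases hg : g = 1
    · -- `g = 1`: the lift is the identity and the augmentation ideal is zero
      have hρg : (ρ g).hom = 𝟙 _ := by
        rw [hρ]
        have : ((MulSemiringAction.toRingEquiv (↥(Subgroup.zpowers σ))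
            (MvPolynomial (Fin 2 × Fin n) k) g⁻¹ :
              MvPolynomial (Fin 2 × Fin n) k ≃+* MvPolynomial (Fin 2 × Fin n) k) :
                MvPolynomial (Fin 2 × Fin n) k →+* MvPolynomial (Fin 2 × Fin n) k) =
            RingHom.id _ := by
          refine RingHom.ext fun b => ?_
          change (MulSemiringAction.toRingEquiv _ _ g⁻¹) b = b
          rw [MulSemiringAction.toRingEquiv_apply_apply, hg, inv_one, one_smul]
        rw [this, CommRingCat.ofHom_id, Spec.map_id]
      have hlift : (hπ.liftAction ρ hJ g).hom = 𝟙 _ :=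
        hπ.eq_id_of_comp_eq (by rw [hπ.liftAction_hom_comp, hρg, Category.comp_id])
      have key : ∀ (f : affineBlowup I ⟶ affineBlowup I) (_ : f = 𝟙 _) (hvf : f.base v = v),
          Ideal.span (Set.range fun s : (affineBlowup I).presheaf.stalk v =>
            ((affineBlowup I).presheaf.stalkSpecializes (specializes_of_eq hvf) ≫
              f.stalkMap v).hom s - s) = ⊥ := by
        intro f hf hvf
        subst hf
        refine Ideal.span_eq_bot.mpr ?_
        rintro _ ⟨s, rfl⟩
        change ((𝟙 (affineBlowup I) : affineBlowup I ⟶ affineBlowup I).stalkMap v).hom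
          (((affineBlowup I).presheaf.stalkSpecializes (specializes_of_eq hvf)).hom s) - s = 0
        erw [Scheme.Hom.stalkMap_id]
        rw [sub_eq_zero]
        exact stalkSpecializes_self_apply (affineBlowup I).presheaf v _ s
      rw [key _ hlift hv]
      exact bot_isPrincipal
    · -- `g ≠ 1`: the centre is the augmentation ideal of `g`, with invariant generators
      exact TerminalBlowup.isPrincipal_stalkAug_liftAction_spec ρ hρ I hπ hJ g
        (fun i : Fin n => (X (0, i) : MvPolynomial (Fin 2 × Fin n) k)) hI.symm
        (fun i => smul_X_fst k n σ h0 g i) (fun b => smul_sub_mem_centre k n σ h0 h1 g b)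
        (fun i => X_fst_mem_augIdeal k n σ h0 h1 p hp g hg i) v hv

/-- **`𝔸²ⁿ/(J₂^{⊕n})` has a resolution of singularities in every characteristic `p`**
(`n ≥ 1`; for `n ≥ 3` the first NON-Cohen–Macaulay wild quotients resolved in the tree):
`nBlocksQuotient_hasResolution_of_model` fed with `nBlocks_terminalModel`. [OURS · L1 W4.5c]
[folklore; assembly of landed decls] -/
theorem nBlocksQuotient_hasResolution (p : ℕ) (hp : p.Prime) (k : Type) [Field k] [CharP k p]
    (n : ℕ) (hn : 0 < n)
    (σ : MvPolynomial (Fin 2 × Fin n) k ≃ₐ[k] MvPolynomial (Fin 2 × Fin n) k)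
    (h0 : ∀ i, σ (X (0, i)) = X (0, i)) (h1 : ∀ i, σ (X (1, i)) = X (1, i) + X (0, i)) :
    Scheme.HasResolution
      (Spec (.of (FixedPoints.subalgebra k (MvPolynomial (Fin 2 × Fin n) k)
        (Subgroup.zpowers σ)))) :=
  nBlocksQuotient_hasResolution_of_model p hp k n hn σ h0 h1
    fun ρ hρ => nBlocks_terminalModel p hp k n hn σ h0 h1 ρ hρ

end Summit.ResolutionOfSingularities.ResolutionOfSingularities.Theorems.WildQuotientResolution.NBlocks

end
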